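import Literature.MathematicalPhysics.QuantumFieldTheory.Balaban1983to89.B9CubeDirichletCLetterDecayAtOne
import Literature.MathematicalPhysics.QuantumFieldTheory.Balaban1983to89.B9Cor36CubeCinvAtOne

/-!
# `Balaban1983to89.B9Cor35CDirInputsAtOne` — [Balaban1985BackgroundPropagators] Cor. 3.5 p. 407 ∕ p. 409 l. 1–5 AT `U = 1` FOR PRINT's DIRICHLET THIRD CUBE
# LETTER `C_□(1) = (Q′_□G′_□(1)²Q′*_□)⁻¹`: node00-def-Y's `XinvCubeDY` AT THE KNIT CUBE LEGS MADE EXPLICIT (both sockets discharged), the conj-`b` letter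
# `CinvDirK`, and THEOREM 3.2 (3.48) FOR IT as the `h348` binder of Sect. B's engines (r05's `B9Cor36CubeCinvAtOne` re-pressed at the Dirichlet letter;
# ROAD (I) U6a; seat dag-n06-c g33)

statement-level skeleton of published theorems with citation tags; proofs where landed; nothing here is a claim about the Yang–Mills mass gap

## What this file does (mathematically)

[Balaban1985BackgroundPropagators] p. 409 l. 1–5: «C_□(U) = (Q′(U)G′_□²(U)Q′*(U))⁻¹ … satisfy all the inequalities of Theorems 3.1–3.3», the inverse taken
with Dirichlet conditions on `Ω₀(□)` (p. 394).  node00-def-Y's `XinvCubeDY i □ 𝔭 G 𝔖 U` is that letter with two DISPLAYED `U = 1` sockets (`hK`: the matrix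
of `G′_□(1)`; `hKX`: an inverse of the compressed block word).  Both are now theorems (g31 `compress_mul_GpDirOneY`; FILE `B9CubeDirichletCLetterAtOne`
`hKX_dirDomY` with the explicit `K_X = kxDirY i □`), so:
* §1 ★ `XinvCubeDY_dirDomY_one` : `XinvCubeDY i □ (parKnitCubeY i □) (GpDirY … Ω₀(□)) 𝔖 1 = (kxDirY i □)♯` (`𝔖 = insideBlkY i □ Ω₀(□)`; `K_X` vanishes off
  `𝔖 × 𝔖`, `compr_kxDirY`), the two compressed laws `X|_𝔖·K_X|_𝔖 = 1 = K_X|_𝔖·X|_𝔖`;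
* §2 the conj-`b` letter `CinvDirK b i □ := conj b (η⁻⁴·XinvCubeDY(…)(1))` (print's units, r05's `CinvK` shape) and `smul_XinvCubeDY_one_liftY`;
* §3 ★★ `h348_dirC` (an entrywise bound of `K_X` ⇒ the block majorant `C·ℓ(a)^{−4}·e^{−δd}` of `CinvDirK` over `toB6 (geoCK i □) Rr H`, r05's `h348_cube`
  verbatim at the Dirichlet letter) and ★★★ `thm32_CinvDirK` : THEOREM 3.2 (3.48) AT `U = 1` for `CinvDirK`, constants depending on `d, L` only, for every
  member with `L·M_h ≥ M₀` (FILE `B9CubeDirichletCLetterDecayAtOne.thm32_dirC_cube`).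

## Status

Printed-statement pass + proof body (proof-backed; a port in the tree's vocabulary): [Balaban1985BackgroundPropagators] pp. 394, 398, 407, 409, re-read
2026-08-31.  Honest label: the `U = 1` Dirichlet third cube letter of def-Y is now an explicit lift with its Theorem 3.2 rows; the `U ≠ 1` letter (Sect. B,
Thm 3.4's engine `thm34_Cinv_uniform_blk` on the `𝔖`-blocks) is NOT run here.  Node N06 of the `pub-ymgap` DAG is NOT discharged here and the Yang–Mills
mass gap is NOT proved here.  NEW file; nothing landed is modified.  No `sorry`, no `axiom`, no `instance`, no `notation`.  Net new unproved facts: 0.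
Cell `pub-ymgap` (HUMAN RULING D-0062), node N06 [B9], seat `pub-ymgap-dag-n06-c` (g33), 2026-08-31.
RELATED, NOT DUPLICATED (searched 2026-08-31: `rg 'CinvDirK|XinvCubeDY_dirDomY_one|h348_dirC|thm32_CinvDirK|compr_kxDirY'` over `Literature ∕ Summits` = ∅): r05
`B9Cor36CubeCinvAtOne` (`CinvK`, `h348_cube` — the WHOLE-TORUS letter; its lemmas `hasMajorant_toLin'_of_abs_le`, `len_reshape_neg4` are USED BY NAME), n06-j
`B9Eq3105DirichletBondLettersAtOneY.XinvCubeDY_parKnitCubeY_GpDirY_one` (the socketed identity, USED BY NAME).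
-/

noncomputable section

namespace Literature.MathematicalPhysics.QuantumFieldTheory.Balaban1983to89.B9Cor35CDirInputsAtOne

open B6KLevelCensusIndexV1 (KIdx kGeo)
open B6Cover236MultiLevelBlocks (cubes)
open B6RandomWalk (HasMajorant hasMajorant_mono)
open B6Geom246MultiLevelTorusL0 (geomT)
open B9Thm34Ext (toB6)
open B9Eq352DivFormLetters (conj)
open B9CubeLettersOpsL0 (cubeFamY oddMh)
open B9CubeLettersBondOpsL0 (BlkCubeY)
open B9Cor35GpCubeInputsAtOne (hasMajorant_conj_of_liftY hasMajorant_smul liftY_smul)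
open B9Cor36CubeCinvAtOne (hasMajorant_toLin'_of_abs_le len_reshape_neg4)
open B9CubeGeometryInputs (geoCK)
open B9Cor35GpDirInputsAtOne (dirDomY GpDirOneY)
open B9CubeDirichletLetterAtOne (compress_mul_GpDirOneY)
open B9Eq3105DirichletBondLettersAtOneY (xDirMatY XinvCubeDY_parKnitCubeY_GpDirY_one)
open B9CubeDirichletCLetterAtOne (kxDirY kxDirY_apply_of_not hKX_dirDomY)
open B9CubeDirichletCLetterDecayAtOne (thm32_dirC_cube)
open Node00 (SiteY toKT liftY liftOpY liftOpY_liftY liftOpY_eq_liftMatY liftMatY)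
open Node00.OpsYCubeDirInverse (indDiagY compr_apply GpDirY)
open Node00.OpsYCubeKnitPar (parKnitCubeY)
open Node00.OpsYCubeProjectionG (insideBlkY XinvCubeDY)
open scoped Matrix

variable {d ℓ : ℕ} {hd : 1 ≤ d + 1} {hL : Odd (ℓ + 1) ∧ 1 < ℓ + 1} {b₀ b₁ : ℝ}
variable {𝔸 : Type} [NormedRing 𝔸] [NormedAlgebra ℂ 𝔸] [CompleteSpace 𝔸]
variable {ι : Type} [Fintype ι] (b : Module.Basis ι ℝ 𝔸)
variable (i : KIdx d ℓ hd hL b₀ b₁) (c : ↥(cubes (toKT i).D.toDomains))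

/-! ## §1 The `U = 1` Dirichlet third cube letter of def-Y, explicit -/

omit [NormedRing 𝔸] [NormedAlgebra ℂ 𝔸] [CompleteSpace 𝔸] in
/-- `K_X` is already compressed: `𝟙_𝔖 K_X 𝟙_𝔖 = K_X`. [cite: Balaban1985BackgroundPropagators, p.409 l.1–5, bookkeeping] -/
theorem compr_kxDirY :
    indDiagY (insideBlkY i c (dirDomY i c)) * kxDirY i c * indDiagY (insideBlkY i c (dirDomY i c)) = kxDirY i c := by
  ext s t
  rw [compr_apply]
  split_ifs with h
  · rfl
  · exact (kxDirY_apply_of_not i c s t h).symm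

/-- ★ **`(Q′_□G′_□(1)²Q′*_□)⁻¹` OF def-Y AT THE KNIT CUBE LEGS, `U = 1`, IS `K_X♯`** — both sockets of n06-j's `XinvCubeDY_parKnitCubeY_GpDirY_one` discharged
(g31 `compress_mul_GpDirOneY`, FILE `B9CubeDirichletCLetterAtOne.hKX_dirDomY`). [cite: Balaban1985BackgroundPropagators, (3.25) p.394, p.409 l.1–5, Cor. 3.5 p.407] -/
theorem XinvCubeDY_dirDomY_one :
    XinvCubeDY i c (parKnitCubeY i c) (GpDirY i c (parKnitCubeY i c) (dirDomY i c)) (insideBlkY i c (dirDomY i c)) (fun _ _ => (1 : 𝔸ˣ)) =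
      liftOpY 𝔸 (kxDirY i c) := by
  rw [XinvCubeDY_parKnitCubeY_GpDirY_one i (dirDomY i c) (compress_mul_GpDirOneY i c) (hKX_dirDomY i c), compr_kxDirY, liftOpY_eq_liftMatY]

omit [NormedRing 𝔸] [NormedAlgebra ℂ 𝔸] [CompleteSpace 𝔸] in
/-- the other compressed law `K_X|_𝔖 · X|_𝔖 = 1` (square matrices). [cite: Balaban1985BackgroundPropagators, p.409 l.1–5; Balaban1984PropagatorsII, Prop. 2.3 p.238, bookkeeping] -/
theorem kxDirY_mul_xDirMatY_inside :
    (kxDirY i c).submatrix (fun v : ↥(insideBlkY i c (dirDomY i c)) => (v : BlkCubeY i c)) (fun v : ↥(insideBlkY i c (dirDomY i c)) => (v : BlkCubeY i c)) *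
      (xDirMatY i c (dirDomY i c) (GpDirOneY i c)).submatrix (fun v : ↥(insideBlkY i c (dirDomY i c)) => (v : BlkCubeY i c))
        (fun v : ↥(insideBlkY i c (dirDomY i c)) => (v : BlkCubeY i c)) = 1 :=
  mul_eq_one_comm.1 (hKX_dirDomY i c)

/-! ## §2 The conj-`b` letter `CinvDirK` -/

/-- **THE DIRICHLET THIRD CUBE LETTER IN THE CONJ-`b` FORM**, print's units: `conj b (η⁻⁴·(Q′_□G′_□(1)²Q′*_□)⁻¹_{Dir})` on `BlkCubeY i □ × ι` (r05's `CinvK` shape).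
[cite: Balaban1985BackgroundPropagators, Thm 3.2 (3.48) p.398, p.409 l.1–5, Cor. 3.5 p.407] -/
def CinvDirK : Module.End ℝ (BlkCubeY i c × ι → ℝ) :=
  conj b (((kGeo i).eta ^ 4)⁻¹ •
    (XinvCubeDY i c (parKnitCubeY i c) (GpDirY i c (parKnitCubeY i c) (dirDomY i c)) (insideBlkY i c (dirDomY i c)) (fun _ _ => (1 : 𝔸ˣ))).restrictScalars ℝ)

/-- `η⁻⁴·C_□(1)(f ⊗ E) = (η⁻⁴·K_X f) ⊗ E`. [cite: Balaban1985BackgroundPropagators, Cor. 3.5 p.407, p.409 l.1–5, bookkeeping] -/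
theorem smul_XinvCubeDY_one_liftY (f : BlkCubeY i c → ℝ) (E : 𝔸) :
    ((((kGeo i).eta ^ 4)⁻¹) •
        (XinvCubeDY i c (parKnitCubeY i c) (GpDirY i c (parKnitCubeY i c) (dirDomY i c)) (insideBlkY i c (dirDomY i c)) (fun _ _ => (1 : 𝔸ˣ))).restrictScalars ℝ)
        (liftY f E) = liftY ((((kGeo i).eta ^ 4)⁻¹ • Matrix.toLin' (kxDirY i c)) f) E := by
  rw [LinearMap.smul_apply, LinearMap.restrictScalars_apply, XinvCubeDY_dirDomY_one i c, liftOpY_liftY, LinearMap.smul_apply, Matrix.toLin'_apply, liftY_smul]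

/-! ## §3 Theorem 3.2 (3.48) at `U = 1` for `CinvDirK` -/

/-- ★★ **BINDER `h348` AT THE DIRICHLET CUBE LETTER**: an entrywise bound `|K_X(y, y′)| ≤ C·((Lʲ)⁴)⁻¹·e^{−δd_T(y,y′)}` gives the block majorant
`CinvDirK ≺ C·ℓ(a)^{−4}·e^{−δd}` over `(toB6 (geoCK i □) Rr H, Prod.fst)` — r05's `h348_cube` at the Dirichlet letter.
[cite: Balaban1985BackgroundPropagators, Thm 3.2 (3.48) p.398, Cor. 3.5 p.407, p.409 l.1–5; Balaban1984PropagatorsII, (2.51) p.232] -/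
theorem h348_dirC {C δ : ℝ} (Rr : ℝ) (H : Prop)
    (hC : ∀ y y' : BlkCubeY i c, |kxDirY i c y y'| ≤ C * ((((ℓ : ℝ) + 1) ^ y.1.1) ^ 4)⁻¹ * Real.exp (-(δ * (geoCK i c).dist y y'))) :
    HasMajorant (g := toB6 (geoCK i c) Rr H) (fun q : BlkCubeY i c × ι => q.1) (CinvDirK b i c)
      (fun a a' => C * (geoCK i c).len a ^ (-(4 : ℝ)) * Real.exp (-(δ * (geoCK i c).dist a a'))) := by
  have hm := hasMajorant_smul (g := toB6 (geoCK i c) Rr H) (fun y : BlkCubeY i c => y) (hasMajorant_toLin'_of_abs_le i c Rr H (kxDirY i c) hC)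
    (((kGeo i).eta ^ 4)⁻¹)
  rw [CinvDirK]
  refine hasMajorant_mono (g := toB6 (geoCK i c) Rr H) _
    (hasMajorant_conj_of_liftY b (g := toB6 (geoCK i c) Rr H) (fun y : BlkCubeY i c => y) _ _ (fun f E => ?_) hm) fun a a' => ?_
  · exact smul_XinvCubeDY_one_liftY i c f E
  · exact (len_reshape_neg4 i c C δ a a').le

/-- ★★★ **THEOREM 3.2 (3.48) AT `U = 1` FOR PRINT's DIRICHLET THIRD CUBE LETTER, conj-`b` form**: constants `δ, C, M₀` depending on `d, L` only such that for
every member with `L·M_h ≥ M₀`, every cover cube and every `Rr, H`, `CinvDirK b i □ ≺ C·ℓ(a)^{−4}·e^{−δ d(a,a′)}` over `(toB6 (geoCK i □) Rr H, Prod.fst)`.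
[cite: Balaban1985BackgroundPropagators, Thm 3.2 (3.48) p.398, p.409 l.1–5, Cor. 3.5 p.407; Balaban1984PropagatorsII, Prop. 2.3 (2.87) p.238; Balaban1983RegularityDecay, (2.42) p.584] -/
theorem thm32_CinvDirK (d ℓ : ℕ) (hℓ : 1 ≤ ℓ) :
    ∃ δ C M₀ : ℝ, 0 < δ ∧ 0 < C ∧ 0 < M₀ ∧
      ∀ {hd : 1 ≤ d + 1} {hL : Odd (ℓ + 1) ∧ 1 < ℓ + 1} {b₀ b₁ : ℝ} (i : KIdx d ℓ hd hL b₀ b₁) (c : ↥(cubes (toKT i).D.toDomains)) (Rr : ℝ) (H : Prop),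
        M₀ ≤ ((ℓ : ℝ) + 1) * (toKT i).Mh →
        HasMajorant (g := toB6 (geoCK i c) Rr H) (fun q : BlkCubeY i c × ι => q.1) (CinvDirK b i c)
          (fun a a' => C * (geoCK i c).len a ^ (-(4 : ℝ)) * Real.exp (-(δ * (geoCK i c).dist a a'))) := by
  obtain ⟨δ, C, M₀, hδ, hC, hM₀, h⟩ := thm32_dirC_cube d ℓ hℓ
  exact ⟨δ, C, M₀, hδ, hC, hM₀, fun i c Rr H hM0 => h348_dirC b i c Rr H (h i c hM0)⟩

end Literature.MathematicalPhysics.QuantumFieldTheory.Balaban1983to89.B9Cor35CDirInputsAtOne
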